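import Summits.MatrixMultiplication.OmegaCensus.DominoZpZpCells
import Summits.MatrixMultiplication.OmegaCensus.DominoZ11StructSevenExcl
import Summits.MatrixMultiplication.OmegaCensus.DominoZ11StructSevenRows1
import Summits.MatrixMultiplication.OmegaCensus.DominoZ11StructSevenRows2
import Summits.MatrixMultiplication.OmegaCensus.DominoZ11StructSevenPairsA
import Summits.MatrixMultiplication.OmegaCensus.DominoZ11StructSevenPairsB
import Summits.MatrixMultiplication.OmegaCensus.DominoZ11Z11Cells
import HarnessLib

/-!
# No domino cube law with a part of size `7` over any `A ↠ ℤ_11 × ℤ_11` (structural route)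

ω-census `pub-omega`, family (b3), seat pub-omega-group gen 24.  Framing: lottery ticket; floor = certified bounds/negative
ranges.  VALUE: per-prime kernel data of the STRUCTURAL part-`7` route (`DominoZpZpStructSeven*.lean`) for `p = 11` —
target: the OPEN census cells `(1,7,23)@484` ×2 (`A = ℤ₄ × ℤ₁₁²`, `ℤ₂² × ℤ₁₁²`) and every larger order; NOT progress on ω.

Assembly: rows `8`–`10` of the completeness check, `checkSevenRest`, `checkSeven_11`, and (with the chunked excluded-list
decides of `DominoZ11StructSevenExcl.lean`)
`exists_entry_structSeven_of_checks` with the decides of `DominoZ11StructSevenData/Rows*/PairsA/PairsB.lean`; cells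
`no_law_cube_17e_of_onto_z11z11` / `no_law_cube_1d7_of_onto_z11z11` = no `(1,1 | 7,7 | e,e)` law triple, either order, any `e`,
in any dihedral-like group (any `c₀`) over ANY finite abelian `A ↠ ℤ_11 × ℤ_11` — census cells `(1,7,23)@484` ×2.
-/

namespace Summit.MatrixMultiplication.OmegaCensus

open Finset ZpZpDomino Literature.Combinatorics.Additive

namespace ZpZpDomino

set_option maxHeartbeats 4000000 in
/-- Row `b = 8` of the completeness check (`11⁴` lookups). [folklore] -/
theorem checkSevenRow_11_8 : checkSevenRow 11 etZ11s7 tabTreeZ11s7 8 = true := by decide +kernel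

set_option maxHeartbeats 4000000 in
/-- Row `b = 9` of the completeness check (`11⁴` lookups). [folklore] -/
theorem checkSevenRow_11_9 : checkSevenRow 11 etZ11s7 tabTreeZ11s7 9 = true := by decide +kernel

set_option maxHeartbeats 4000000 in
/-- Row `b = 10` of the completeness check (`11⁴` lookups). [folklore] -/
theorem checkSevenRow_11_10 : checkSevenRow 11 etZ11s7 tabTreeZ11s7 10 = true := by decide +kernel

set_option maxHeartbeats 4000000 in
/-- The remaining normalised tuples. [folklore] -/
theorem checkSevenRest_11 : checkSevenRest 11 etZ11s7 tabTreeZ11s7 = true := by decide +kernel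

/-- **Completeness** (rows assembled). [folklore] -/
theorem checkSeven_11 : checkSeven 11 etZ11s7 tabTreeZ11s7 = true := by
  refine checkSeven_of_rows (fun b hb => ?_) checkSevenRest_11
  interval_cases b
  exacts [checkSevenRow_11_0, checkSevenRow_11_1, checkSevenRow_11_2, checkSevenRow_11_3, checkSevenRow_11_4, checkSevenRow_11_5, checkSevenRow_11_6, checkSevenRow_11_7, checkSevenRow_11_8, checkSevenRow_11_9, checkSevenRow_11_10]

/-- **Every value function of sum `7` on `ZMod 11 × ZMod 11` has a line direction whose count vector is, up to a unit scaling,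
a certified entry of `tableZ11s7`** (structural part-`7` route). [folklore] -/
theorem exists_table_entry_11_7s (g : Fin (11 * 11) → ℕ) (hg : ∑ i, g i = 7)
    (_hNF : (1 ≤ g ⟨11, by decide⟩ ∧ 1 ≤ g ⟨1, by decide⟩) ∨
      (1 ≤ g ⟨11, by decide⟩ ∧ ∀ i : Fin (11 * 11), i.val % 11 ≠ 0 → g i = 0) ∨ (∀ i : Fin (11 * 11), i.val ≠ 0 → g i = 0)) :
    ∃ j < 11 + 1, ∃ k : ℕ, k % 11 ≠ 0 ∧ ∃ e ∈ tableZ11s7, ∀ v < 11,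
      e.1.getD (k * v % 11) 0 = ∑ i : Fin (11 * 11), pick v (pv 11 j i.val) (g i) :=
  haveI : Fact (Nat.Prime 11) := ⟨by decide⟩
  exists_entry_structSeven_of_checks (by decide) eZ11s7 rZ11s7 2 etZ11s7 checkE1seven_11
    (checkE2g_of_checkE2gt checkEwf7_11 etZ11s7_sound checkE2gt7_11) checkR7_11
    etZ11s7_complete checkH7a_11 checkH7b_11 tableZ11s7 tabTreeZ11s7 (fun _ h => mem_tabTree h) tableZ11s7_wf checkEwf7_11
    etZ11s7_sound checkSeven_11 g hg

end ZpZpDomino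

variable {A : Type} [AddCommGroup A] [DecidableEq A] [Fintype A] {G : Type} [Group G] [DecidableEq G]
  {ρ τ : A → G} {c₀ : A} {S T U : Finset G}

/-- **No `(1,1 | 7,7 | e,e)` law triple over `A ↠ ℤ_11 × ℤ_11`** (dihedral-like `G`, any `c₀`, `φ` onto). [folklore] -/
theorem no_law_cube_17e_of_onto_z11z11
    (hρρ : ∀ a b, ρ a * ρ b = ρ (a + b)) (hρτ : ∀ a b, ρ a * τ b = τ (b - a))
    (hτρ : ∀ a b, τ a * ρ b = τ (a + b)) (hττ : ∀ a b, τ a * τ b = ρ (c₀ + b - a))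
    (hρ : Function.Injective ρ) (hτ : Function.Injective τ) (hne : ∀ a b, ρ a ≠ τ b)
    (hsurj : ∀ g, (∃ a, ρ a = g) ∨ (∃ a, τ a = g))
    (φ : A →+ ZMod 11 × ZMod 11) (hφ : Function.Surjective φ)
    (h : TripleProductProperty S T U)
    (hS₀ : (univ.filter fun a : A => ρ a ∈ S).card = 1) (hS₁ : (univ.filter fun a : A => τ a ∈ S).card = 1)
    (hT₀ : (univ.filter fun a : A => ρ a ∈ T).card = 7) (hT₁ : (univ.filter fun a : A => τ a ∈ T).card = 7)
    (hU : (univ.filter fun a : A => ρ a ∈ U).card = (univ.filter fun a : A => τ a ∈ U).card)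
    (hV : 3 * (S.card * T.card * U.card) + 8 = 8 * Fintype.card A) : False :=
  haveI : Fact (Nat.Prime 11) := ⟨by decide⟩
  no_law_cube_1de_of_onto_zpzp_of_cover (6 : ZMod 11) half_zmod11 tableZ11s7 tableZ11s7_cert ⟨11, by decide⟩ ⟨1, by decide⟩
    rfl rfl exists_table_entry_11_7s hρρ hρτ hτρ hττ hρ hτ hne hsurj φ hφ h hS₀ hS₁ hT₀ hT₁ hU hV

/-- **No `(1,1 | d,d | 7,7)` law triple over `A ↠ ℤ_11 × ℤ_11`** (dihedral-like `G`, any `c₀`, `φ` onto). [folklore] -/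
theorem no_law_cube_1d7_of_onto_z11z11
    (hρρ : ∀ a b, ρ a * ρ b = ρ (a + b)) (hρτ : ∀ a b, ρ a * τ b = τ (b - a))
    (hτρ : ∀ a b, τ a * ρ b = τ (a + b)) (hττ : ∀ a b, τ a * τ b = ρ (c₀ + b - a))
    (hρ : Function.Injective ρ) (hτ : Function.Injective τ) (hne : ∀ a b, ρ a ≠ τ b)
    (hsurj : ∀ g, (∃ a, ρ a = g) ∨ (∃ a, τ a = g))
    (φ : A →+ ZMod 11 × ZMod 11) (hφ : Function.Surjective φ)
    (h : TripleProductProperty S T U)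
    (hS₀ : (univ.filter fun a : A => ρ a ∈ S).card = 1) (hS₁ : (univ.filter fun a : A => τ a ∈ S).card = 1)
    (hT : (univ.filter fun a : A => ρ a ∈ T).card = (univ.filter fun a : A => τ a ∈ T).card)
    (hU₀ : (univ.filter fun a : A => ρ a ∈ U).card = 7) (hU₁ : (univ.filter fun a : A => τ a ∈ U).card = 7)
    (hV : 3 * (S.card * T.card * U.card) + 8 = 8 * Fintype.card A) : False :=
  haveI : Fact (Nat.Prime 11) := ⟨by decide⟩
  no_law_cube_1d_e_of_onto_zpzp_of_cover (6 : ZMod 11) half_zmod11 tableZ11s7 tableZ11s7_cert ⟨11, by decide⟩ ⟨1, by decide⟩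
    rfl rfl exists_table_entry_11_7s hρρ hρτ hτρ hττ hρ hτ hne hsurj φ hφ h hS₀ hS₁ hT hU₀ hU₁ hV

end Summit.MatrixMultiplication.OmegaCensus
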